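/-
Copyright (c) 2026 the pub-hodgecm-mathlib formalisation cell (harness21).  Prover seat hodgecm-mathlib-K2Liu-p01 (g12) (K1a lineage), Track B «K2-LIT» ∕
hLiu418 = `stmt-HodgeConjecture-24832`; LEAD F0P6-plan (g16) BATCH #304 (2) deal (Q4) «the ASSEMBLER, hypothesis-first»; K1a (C-K) desk K2E4-p10 (g11) memo
`CK-CENSUS.md` (Q2)∕(Q4).  THEOREMS ONLY (no `def`, no instance, no notation, no named-fact hypothesis, no `sorry`, default heartbeats); lane
`--supports stmt-HodgeConjecture-24832 --as helper`.
-/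
import Summits.HodgeConjecture.HodgeConjecture.Theorems.K2LiuKindOneSingularArchLettersOfRecord    -- ★ p865046∕p865080: the corner-datum vocabulary, `gaussParam_pos`
import HarnessLib

/-!
# Crux `HLiu418`, socket #41 ∕ #42S, KIND 1 a♮ — (Q4) `K2LiuKindOneSingularArchLettersOfRecordK`: THE `g`-LEVEL ARCH ALPHABET AT GENERAL MATRIX `K_w`-TYPE,
# ASSEMBLED FROM THE (C-K) CLASS LETTERS BY VALUE (road (A) «RUNGS», LEAD RULING M-160m)

Cell `hodgecm-mathlib`, hLiu418 = `stmt-HodgeConjecture-24832` (helper lane, count-neutral); squad K2 ∕ K2Liu, road `K2_Liu`, KIND 1 a♮.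

THE POINT.  The tie's arch column of record ★ p864726 `blockD_arch_of_record` takes, per FINE face `p` (a flat-tube term of a (KW-fac) face, ★ FILE 18
`exists_flat_tube_presentation`) and complex place `w`, a continuation `Ac₀ X p w s g` of the local twisted block as a function of `g ∈ U(J)(ℂ)` — letters (C)
`hAc₀` (holomorphy on `{0 < re s}`) and `hA₀` (agreement with the local integral on `{½ < re s}`) — and ★ p864498 `hAcb_of_archLetters` wants the growth letter
(iv) `hAcwb` (with `hP1`) about the composite `Acw := Ac₀ ∘ Frg`.  ★ p865128 `archLetters_of_scalarTypeGrowth_g` produced all of these on the SCALAR stratum, where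
the local flat family at `(p, w)` is `archScalarSection (k p w) s` and the letters are ★ p864912 ∕ ★ p864948 (explicit, datum-uniform, with growth (v)).  The (W3)
verdict (typ4 (g4), K1a WORD #33): the fine faces carry GENERAL `K_w`-finite pictures, so the local family at `(p, w)` is a general FLAT family
`G p w s : U(J)(ℂ) → ℂ` (★ FILE 18's `‖j(·,i1)‖^{2(2−s)}·F r w`, fixed compact picture `Q r w`), whose twisted-block letters are the business of the (C-K) road:
(C-K-1) ★ p865381 `K2LiuArchTwistedRayAtomBounds` → (C-K-2) the CLASS file `K2LiuArchTwistedKTypeRungClass` (`rungClass_letters`) → (C-K-3) finite rung depth.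
THIS FILE is the (Q4) ASSEMBLER, HYPOTHESIS-FIRST: it takes the class letters BY VALUE, per fine face `i : φ`, complex place `w` and SIGN, in the desk memo's (Q2)
shape = ★ p864912's clauses (i) (ii) (v) VERBATIM with `archScalarSection k s` replaced by the abstract family `G i w s` (binders `hKp`, `hKn`; constants of (v) per
`(i, w)`), and returns ★ p865128's conclusion at general `K_w`-type: (C1) = ★ p864726's `hAc₀` bytes, (C2p)∕(C2n) the `g`-level agreement
`sc·∫ e(∓tr(a·diag(tw,0)·aᴴ·X_r)) · G p w s (J n(X_r) g) dr = Ac₀ X p w s g` on `{½ < re s}` by the sign (the (ρ) ED. 3 reading turns it into ★ p864726's `hA₀`),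
(C3) `hP1` and (C4) `hAcwb` of ★ p864498 at `Acw := Ac₀ ∘ Frg` with the booked `Pw`, `gw := tw·pw`, `cg := π` (constants uniform over the finitely many `(i, w)`,
times the scalar bound `Cs`).  So the three ARCH-CONT slots of the ties (#42S v31 :783∕:796 `Ac₀ hAc₀ hA₀`; #41 v44 :463–:467 `Ac hAc hA` via ★ p864726 + ★ p864619 on
top) close BY NAME modulo the class file the day it lands: the tie pays `hKp hKn` by `rungClass_letters` ∘ (C-K-3) at the pictures `Q r w`.
* **`archLetters_of_kTypeGrowth_g`** — proof = ★ p865128's, with the two `choose … using ★ p864912 ∕ ★ p864948` lines replaced by `choose … using hKp ∕ hKn`.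
NOT PRODUCED HERE (honest): ★ p865128's sign-letter zeros (C5)(C6) — at general `K_w`-type they need (C-K-3)'s explicit `s`-rational form; the D-3 `hAzero` slot keeps
its own lineage.
[Shimura1982, §4 Thm. 4.2, (4.34.K)], [Shimura1997, §18.4–18.5], [KudlaRallis1994, §2 (2.10)–(2.12)], [LeeZhu1998, §5], [GanQiuTakeda2014, §6.4].
HONEST LABEL.  Re-packaging, count-neutral; closes no socket: `HC_CM` is proved only modulo the 7 printed citations (2 remaining named inputs: hLiu418 =
`stmt-HodgeConjecture-24832`, h413 = `stmt-HodgeConjecture-24833`) until rung 0 closes.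

## References
* [Shimura1982] G. Shimura, *Confluent hypergeometric functions on tube domains*, Math. Ann. 260 (1982): §4 Thm. 4.2, (4.34.K).
* [Shimura1997] G. Shimura, *Euler Products and Eisenstein Series*, CBMS 93 (1997): §18.4–18.5.
* [KudlaRallis1994] S. Kudla, S. Rallis, *A regularized Siegel–Weil formula: the first term identity*, Ann. of Math. 140 (1994): §2 (2.10)–(2.12).
* [LeeZhu1998] S. T. Lee, C.-B. Zhu, *Degenerate principal series and local theta correspondence*, Trans. AMS 350 (1998): §5.
* [GanQiuTakeda2014] W. T. Gan, Y. Qiu, S. Takeda, *The regularized Siegel–Weil formula (the second term identity)*, Invent. Math. 198 (2014): §6.4.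
-/

set_option autoImplicit false
set_option linter.dupNamespace false -- the mandated namespace repeats `HodgeConjecture.HodgeConjecture`

noncomputable section

open scoped Matrix ComplexConjugate ComplexOrder
open Complex Matrix NumberField NumberField.InfinitePlace IsDedekindDomain MeasureTheory
open Literature.NumberTheory.ModularForms.SiegelUpperHalfSpace (moeb)
open Literature.NumberTheory.Automorphic Literature.NumberTheory.Automorphic.UnitaryGroup Literature.NumberTheory.GaloisRepresentations
open Literature.NumberTheory.GelbartRogawski1991 Literature.NumberTheory.GelbartRogawski1991.GRConstruction

namespace Summit.HodgeConjecture.HodgeConjecture.Cruxes.HLiu418.K2LiuKindOneSingularArchLettersOfRecordK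

open K2LiuSiegelUnipotentFourierDefs
open K2LiuHermTwoGammaDefs (hermTwo)
open K2LiuArchInducedTubeDefs (hermOfReal)
open K2LiuHermTwoEtaRankOneWitnessGrowth (one_le_envFactor)
open K2LiuKindOneSingularArchLettersOfRecord (gaussParam_pos)

variable (L : Type) [Field L] [NumberField L] [IsCMField L] {N M : ℕ} (e : Fin N × Fin M ≃ Fin 2)
  (dV : Fin N → L) (hdV : ∀ i, IsCMField.complexConj L (dV i) = dV i)
  (dW : Fin M → L) (hdW : ∀ i, IsCMField.complexConj L (dW i) = dW i)

/-- **THE `g`-LEVEL ARCH ALPHABET PRODUCER AT GENERAL MATRIX `K_w`-TYPE (hypothesis-first on the (C-K) class letters).**  Inputs by value as in ★ p865128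
`archLetters_of_scalarTypeGrowth_g`: faces `I`, places `Tinf`, frame `a` (`‖det a‖ = 1`), translate `gc`, tube frame `Fr ∈ U(J)` (`hFrU`), `tw > 0`, `pw` read as
★ p864004's exponent at the translate (`hpw_eq`), entry bound `Rw` (`hRw`), sign split `sgn`, per-place scalar `sc` (`hsc hscb`); and, replacing the scalar `K_∞`-types,
the local FLAT FAMILIES `G i w s : U(J)(ℂ) → ℂ` per fine face `i : φ` and complex place `w` together with their CLASS LETTERS BY VALUE — `hKp` (index
`a·diag(t,0)·aᴴ`) and `hKn` (index `−a·diag(t,0)·aᴴ`): for every `(i, w)` ONE datum-uniform `Ac : (a, t, s, h) ↦ ℂ` with (i) holomorphy on `{0 < re s}` for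
`h ∈ U(J)`, (ii) `∫ e(∓tr(a·diag(t,0)·aᴴ·X_r)) · G i w s (J n(X_r) h) dr = Ac a t s h` for `½ < re s`, (v) the growth
`‖Ac a t s h‖ ≤ Cg·((1+P)(1+P⁻¹)(1+t)(1+t⁻¹)(1+R))^{Mg}·exp(−π·P·t)` near every `z` (`0 < re z`), `P = Re (aᴴ(2·Im(h·i1))a)₀₀` — ★ p864912 (i)(ii)(v) VERBATIM with
`archScalarSection k s ↦ G i w s` (the (C-K-2) `rungClass_letters` ∘ (C-K-3) currency, desk memo (Q2)).  Output: `Ac₀` at the `g`-level with (C1) = ★ p864726's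
`hAc₀`, (C2p∕C2n) the agreement with `sc·∫(±, g)` on `{½ < re s}`, (C3) `hP1`, (C4) `hAcwb` of ★ p864498 about `Ac₀ X p w s (Fr((gc X·h)_∞) w)`.
[cite: Shimura1982, §4 Thm. 4.2, (4.34.K)] [cite: Shimura1997, §18.4–18.5] [cite: KudlaRallis1994, §2 (2.10)–(2.12)] [cite: LeeZhu1998, §5] -/
theorem archLetters_of_kTypeGrowth_g {φ : Type*} [Fintype φ]
    (I : skewMatrices ((IsCMField.complexConj L : L ≃ₐ[Fp L] L) : L →+* L) ((gramR L e dV hdV dW hdW).map (algebraMap (Fp L) L)) → HA L e dV hdV dW hdW → Finset φ)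
    (Tinf : Finset (InfinitePlace L))
    (a : Matrix (Fin 2) (Fin 2) ℂ) (ha : ‖a.det‖ = 1)
    (gc : skewMatrices ((IsCMField.complexConj L : L ≃ₐ[Fp L] L) : L →+* L) ((gramR L e dV hdV dW hdW).map (algebraMap (Fp L) L)) → HA L e dV hdV dW hdW)
    (Fr : UnitaryGroup.arch (Fp L) L (IsCMField.complexConj L) (2 + 2) (hermD L e dV hdV dW hdW) → {w : InfinitePlace L // w.IsComplex} →
      Matrix (Fin 2 ⊕ Fin 2) (Fin 2 ⊕ Fin 2) ℂ)
    (hFrU : ∀ (x : UnitaryGroup.arch (Fp L) L (IsCMField.complexConj L) (2 + 2) (hermD L e dV hdV dW hdW)) (w : {w : InfinitePlace L // w.IsComplex}),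
      (Fr x w)ᴴ * Matrix.J (Fin 2) ℂ * Fr x w = Matrix.J (Fin 2) ℂ)
    (tw : skewMatrices ((IsCMField.complexConj L : L ≃ₐ[Fp L] L) : L →+* L) ((gramR L e dV hdV dW hdW).map (algebraMap (Fp L) L)) → InfinitePlace L → ℝ)
    (htw0 : ∀ X : skewMatrices ((IsCMField.complexConj L : L ≃ₐ[Fp L] L) : L →+* L) ((gramR L e dV hdV dW hdW).map (algebraMap (Fp L) L)),
      (X : Matrix (Fin 2) (Fin 2) L) ≠ 0 → (X : Matrix (Fin 2) (Fin 2) L).det = 0 → ∀ w' ∈ Tinf, 0 < tw X w')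
    (pw Rw : skewMatrices ((IsCMField.complexConj L : L ≃ₐ[Fp L] L) : L →+* L) ((gramR L e dV hdV dW hdW).map (algebraMap (Fp L) L)) → HA L e dV hdV dW hdW →
      InfinitePlace L → ℝ)
    (hpw_eq : ∀ (X : skewMatrices ((IsCMField.complexConj L : L ≃ₐ[Fp L] L) : L →+* L) ((gramR L e dV hdV dW hdW).map (algebraMap (Fp L) L)))
      (h : HA L e dV hdV dW hdW) (w' : InfinitePlace L),
      pw X h w' = ((aᴴ * ((2 : ℂ) • ((2 * Complex.I)⁻¹ •
        (moeb (Fr (UnitaryGroup.archPart (Fp L) L (IsCMField.complexConj L) (2 + 2) (hermD L e dV hdV dW hdW) (gc X * h)) ⟨w', IsTotallyComplex.isComplex w'⟩)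
            (Complex.I • (1 : Matrix (Fin 2) (Fin 2) ℂ)) -
          (moeb (Fr (UnitaryGroup.archPart (Fp L) L (IsCMField.complexConj L) (2 + 2) (hermD L e dV hdV dW hdW) (gc X * h)) ⟨w', IsTotallyComplex.isComplex w'⟩)
            (Complex.I • (1 : Matrix (Fin 2) (Fin 2) ℂ)))ᴴ))) * a) 0 0).re)
    (hRw : ∀ (X : skewMatrices ((IsCMField.complexConj L : L ≃ₐ[Fp L] L) : L →+* L) ((gramR L e dV hdV dW hdW).map (algebraMap (Fp L) L)))
      (h : HA L e dV hdV dW hdW), ∀ w' ∈ Tinf, ∀ i j,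
      ‖Fr (UnitaryGroup.archPart (Fp L) L (IsCMField.complexConj L) (2 + 2) (hermD L e dV hdV dW hdW) (gc X * h)) ⟨w', IsTotallyComplex.isComplex w'⟩ i j‖ ≤ Rw X h w')
    -- the local FLAT families per fine face and complex place (★ FILE 18's `‖j(·,i1)‖^{2(2−s)}·F r w`, read at the record's left frame), general matrix `K_w`-type
    (G : φ → {w : InfinitePlace L // w.IsComplex} → ℂ → Matrix (Fin 2 ⊕ Fin 2) (Fin 2 ⊕ Fin 2) ℂ → ℂ)
    -- the (C-K) CLASS LETTERS BY VALUE, positive framed corner index: ★ p864912 (i)(ii)(v) with `archScalarSection k s ↦ G i w s`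
    (hKp : ∀ (i : φ) (w : {w : InfinitePlace L // w.IsComplex}),
      ∃ Ac : Matrix (Fin 2) (Fin 2) ℂ → ℝ → ℂ → Matrix (Fin 2 ⊕ Fin 2) (Fin 2 ⊕ Fin 2) ℂ → ℂ,
        (∀ (a : Matrix (Fin 2) (Fin 2) ℂ) (t : ℝ), ‖a.det‖ = 1 → 0 < t →
          ∀ h : Matrix (Fin 2 ⊕ Fin 2) (Fin 2 ⊕ Fin 2) ℂ, hᴴ * Matrix.J (Fin 2) ℂ * h = Matrix.J (Fin 2) ℂ →
            DifferentiableOn ℂ (fun s => Ac a t s h) {s : ℂ | 0 < s.re}) ∧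
        (∀ (a : Matrix (Fin 2) (Fin 2) ℂ) (t : ℝ), ‖a.det‖ = 1 → 0 < t →
          ∀ s : ℂ, 1 / 2 < s.re → ∀ h : Matrix (Fin 2 ⊕ Fin 2) (Fin 2 ⊕ Fin 2) ℂ, hᴴ * Matrix.J (Fin 2) ℂ * h = Matrix.J (Fin 2) ℂ →
            (∫ r : Fin 2 → Fin 2 → ℝ, cexp (-(2 * Real.pi * Complex.I) * ((a * hermTwo (t, 0, 0) * aᴴ) * hermOfReal r).trace) *
              G i w s (Matrix.J (Fin 2) ℂ * fromBlocks 1 (hermOfReal r) 0 1 * h)) = Ac a t s h) ∧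
        (∀ z : ℂ, 0 < z.re → ∃ (Mg : ℕ) (Cg r : ℝ), 0 ≤ Cg ∧ 0 < r ∧
          ∀ (a : Matrix (Fin 2) (Fin 2) ℂ) (t : ℝ), ‖a.det‖ = 1 → 0 < t →
          ∀ h : Matrix (Fin 2 ⊕ Fin 2) (Fin 2 ⊕ Fin 2) ℂ, hᴴ * Matrix.J (Fin 2) ℂ * h = Matrix.J (Fin 2) ℂ →
          ∀ R : ℝ, (∀ i j, ‖h i j‖ ≤ R) → ∀ s : ℂ, dist s z < r →
            ‖Ac a t s h‖ ≤
              Cg * ((((1 + ((aᴴ * ((2 : ℂ) • ((2 * Complex.I)⁻¹ • (moeb h (Complex.I • (1 : Matrix (Fin 2) (Fin 2) ℂ)) -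
                      (moeb h (Complex.I • (1 : Matrix (Fin 2) (Fin 2) ℂ)))ᴴ))) * a) 0 0).re) *
                  (1 + (((aᴴ * ((2 : ℂ) • ((2 * Complex.I)⁻¹ • (moeb h (Complex.I • (1 : Matrix (Fin 2) (Fin 2) ℂ)) -
                      (moeb h (Complex.I • (1 : Matrix (Fin 2) (Fin 2) ℂ)))ᴴ))) * a) 0 0).re)⁻¹)) *
                  ((1 + t) * (1 + t⁻¹))) * (1 + R)) ^ Mg *
                Real.exp (-(Real.pi * ((((aᴴ * ((2 : ℂ) • ((2 * Complex.I)⁻¹ • (moeb h (Complex.I • (1 : Matrix (Fin 2) (Fin 2) ℂ)) -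
                  (moeb h (Complex.I • (1 : Matrix (Fin 2) (Fin 2) ℂ)))ᴴ))) * a) 0 0).re) * t)))))
    -- the (C-K) CLASS LETTERS BY VALUE, negative framed corner index: ★ p864948 (i)(ii)(v) with `archScalarSection k s ↦ G i w s`
    (hKn : ∀ (i : φ) (w : {w : InfinitePlace L // w.IsComplex}),
      ∃ Ac : Matrix (Fin 2) (Fin 2) ℂ → ℝ → ℂ → Matrix (Fin 2 ⊕ Fin 2) (Fin 2 ⊕ Fin 2) ℂ → ℂ,
        (∀ (a : Matrix (Fin 2) (Fin 2) ℂ) (t : ℝ), ‖a.det‖ = 1 → 0 < t →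
          ∀ h : Matrix (Fin 2 ⊕ Fin 2) (Fin 2 ⊕ Fin 2) ℂ, hᴴ * Matrix.J (Fin 2) ℂ * h = Matrix.J (Fin 2) ℂ →
            DifferentiableOn ℂ (fun s => Ac a t s h) {s : ℂ | 0 < s.re}) ∧
        (∀ (a : Matrix (Fin 2) (Fin 2) ℂ) (t : ℝ), ‖a.det‖ = 1 → 0 < t →
          ∀ s : ℂ, 1 / 2 < s.re → ∀ h : Matrix (Fin 2 ⊕ Fin 2) (Fin 2 ⊕ Fin 2) ℂ, hᴴ * Matrix.J (Fin 2) ℂ * h = Matrix.J (Fin 2) ℂ →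
            (∫ r : Fin 2 → Fin 2 → ℝ, cexp (-(2 * Real.pi * Complex.I) * ((-(a * hermTwo (t, 0, 0) * aᴴ)) * hermOfReal r).trace) *
              G i w s (Matrix.J (Fin 2) ℂ * fromBlocks 1 (hermOfReal r) 0 1 * h)) = Ac a t s h) ∧
        (∀ z : ℂ, 0 < z.re → ∃ (Mg : ℕ) (Cg r : ℝ), 0 ≤ Cg ∧ 0 < r ∧
          ∀ (a : Matrix (Fin 2) (Fin 2) ℂ) (t : ℝ), ‖a.det‖ = 1 → 0 < t →
          ∀ h : Matrix (Fin 2 ⊕ Fin 2) (Fin 2 ⊕ Fin 2) ℂ, hᴴ * Matrix.J (Fin 2) ℂ * h = Matrix.J (Fin 2) ℂ →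
          ∀ R : ℝ, (∀ i j, ‖h i j‖ ≤ R) → ∀ s : ℂ, dist s z < r →
            ‖Ac a t s h‖ ≤
              Cg * ((((1 + ((aᴴ * ((2 : ℂ) • ((2 * Complex.I)⁻¹ • (moeb h (Complex.I • (1 : Matrix (Fin 2) (Fin 2) ℂ)) -
                      (moeb h (Complex.I • (1 : Matrix (Fin 2) (Fin 2) ℂ)))ᴴ))) * a) 0 0).re) *
                  (1 + (((aᴴ * ((2 : ℂ) • ((2 * Complex.I)⁻¹ • (moeb h (Complex.I • (1 : Matrix (Fin 2) (Fin 2) ℂ)) -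
                      (moeb h (Complex.I • (1 : Matrix (Fin 2) (Fin 2) ℂ)))ᴴ))) * a) 0 0).re)⁻¹)) *
                  ((1 + t) * (1 + t⁻¹))) * (1 + R)) ^ Mg *
                Real.exp (-(Real.pi * ((((aᴴ * ((2 : ℂ) • ((2 * Complex.I)⁻¹ • (moeb h (Complex.I • (1 : Matrix (Fin 2) (Fin 2) ℂ)) -
                  (moeb h (Complex.I • (1 : Matrix (Fin 2) (Fin 2) ℂ)))ᴴ))) * a) 0 0).re) * t)))))
    (sgn : skewMatrices ((IsCMField.complexConj L : L ≃ₐ[Fp L] L) : L →+* L) ((gramR L e dV hdV dW hdW).map (algebraMap (Fp L) L)) → InfinitePlace L → Bool)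
    (sc : skewMatrices ((IsCMField.complexConj L : L ≃ₐ[Fp L] L) : L →+* L) ((gramR L e dV hdV dW hdW).map (algebraMap (Fp L) L)) → φ → InfinitePlace L → ℂ → ℂ)
    (hsc : ∀ (X : skewMatrices ((IsCMField.complexConj L : L ≃ₐ[Fp L] L) : L →+* L) ((gramR L e dV hdV dW hdW).map (algebraMap (Fp L) L))) (i : φ)
      (w' : InfinitePlace L), DifferentiableOn ℂ (sc X i w') {s : ℂ | 0 < s.re})
    (hscb : ∀ z : ℂ, 0 < z.re → ∃ (Cs rs : ℝ), 0 ≤ Cs ∧ 0 < rs ∧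
      ∀ X : skewMatrices ((IsCMField.complexConj L : L ≃ₐ[Fp L] L) : L →+* L) ((gramR L e dV hdV dW hdW).map (algebraMap (Fp L) L)),
      (X : Matrix (Fin 2) (Fin 2) L) ≠ 0 → (X : Matrix (Fin 2) (Fin 2) L).det = 0 → ∀ (h : HA L e dV hdV dW hdW), ∀ i ∈ I X h, ∀ w' ∈ Tinf,
      ∀ s : ℂ, dist s z < rs → ‖sc X i w' s‖ ≤ Cs) :
    ∃ Ac₀ : skewMatrices ((IsCMField.complexConj L : L ≃ₐ[Fp L] L) : L →+* L) ((gramR L e dV hdV dW hdW).map (algebraMap (Fp L) L)) → φ → InfinitePlace L → ℂ →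
        Matrix (Fin 2 ⊕ Fin 2) (Fin 2 ⊕ Fin 2) ℂ → ℂ,
      -- (C1) `hAc₀` (★ p864726 :118–:120, at `∀ p ∈ I X h`)
      (∀ X : skewMatrices ((IsCMField.complexConj L : L ≃ₐ[Fp L] L) : L →+* L) ((gramR L e dV hdV dW hdW).map (algebraMap (Fp L) L)),
        (X : Matrix (Fin 2) (Fin 2) L) ≠ 0 → (X : Matrix (Fin 2) (Fin 2) L).det = 0 → ∀ (h : HA L e dV hdV dW hdW), ∀ p ∈ I X h, ∀ w ∈ Tinf,
          ∀ g : Matrix (Fin 2 ⊕ Fin 2) (Fin 2 ⊕ Fin 2) ℂ, gᴴ * Matrix.J (Fin 2) ℂ * g = Matrix.J (Fin 2) ℂ →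
            DifferentiableOn ℂ (fun s => Ac₀ X p w s g) {s : ℂ | 0 < s.re}) ∧
      -- (C2p) the `g`-level agreement, positive framed corner index, scalar outside, general `K_w`-type family `G p w s`
      (∀ X : skewMatrices ((IsCMField.complexConj L : L ≃ₐ[Fp L] L) : L →+* L) ((gramR L e dV hdV dW hdW).map (algebraMap (Fp L) L)),
        (X : Matrix (Fin 2) (Fin 2) L) ≠ 0 → (X : Matrix (Fin 2) (Fin 2) L).det = 0 → ∀ (h : HA L e dV hdV dW hdW), ∀ p ∈ I X h, ∀ w ∈ Tinf, sgn X w = true →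
          ∀ s : ℂ, 1 / 2 < s.re → ∀ g : Matrix (Fin 2 ⊕ Fin 2) (Fin 2 ⊕ Fin 2) ℂ, gᴴ * Matrix.J (Fin 2) ℂ * g = Matrix.J (Fin 2) ℂ →
          sc X p w s * (∫ r : Fin 2 → Fin 2 → ℝ, cexp (-(2 * Real.pi * Complex.I) * ((a * hermTwo (tw X w, 0, 0) * aᴴ) * hermOfReal r).trace) *
            G p ⟨w, IsTotallyComplex.isComplex w⟩ s (Matrix.J (Fin 2) ℂ * fromBlocks 1 (hermOfReal r) 0 1 * g)) = Ac₀ X p w s g) ∧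
      -- (C2n) the `g`-level agreement, negative framed corner index, scalar outside, general `K_w`-type family `G p w s`
      (∀ X : skewMatrices ((IsCMField.complexConj L : L ≃ₐ[Fp L] L) : L →+* L) ((gramR L e dV hdV dW hdW).map (algebraMap (Fp L) L)),
        (X : Matrix (Fin 2) (Fin 2) L) ≠ 0 → (X : Matrix (Fin 2) (Fin 2) L).det = 0 → ∀ (h : HA L e dV hdV dW hdW), ∀ p ∈ I X h, ∀ w ∈ Tinf, sgn X w = false →
          ∀ s : ℂ, 1 / 2 < s.re → ∀ g : Matrix (Fin 2 ⊕ Fin 2) (Fin 2 ⊕ Fin 2) ℂ, gᴴ * Matrix.J (Fin 2) ℂ * g = Matrix.J (Fin 2) ℂ →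
          sc X p w s * (∫ r : Fin 2 → Fin 2 → ℝ, cexp (-(2 * Real.pi * Complex.I) * ((-(a * hermTwo (tw X w, 0, 0) * aᴴ)) * hermOfReal r).trace) *
            G p ⟨w, IsTotallyComplex.isComplex w⟩ s (Matrix.J (Fin 2) ℂ * fromBlocks 1 (hermOfReal r) 0 1 * g)) = Ac₀ X p w s g) ∧
      -- (C3) `hP1` (★ p864498 :114–:115) at the booked `Pw`
      (∀ (X : skewMatrices ((IsCMField.complexConj L : L ≃ₐ[Fp L] L) : L →+* L) ((gramR L e dV hdV dW hdW).map (algebraMap (Fp L) L))) (h : HA L e dV hdV dW hdW),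
        (X : Matrix (Fin 2) (Fin 2) L) ≠ 0 → (X : Matrix (Fin 2) (Fin 2) L).det = 0 → ∀ w ∈ Tinf,
          1 ≤ ((1 + pw X h w) * (1 + (pw X h w)⁻¹)) * ((1 + tw X w) * (1 + (tw X w)⁻¹)) * (1 + Rw X h w)) ∧
      -- (C4) `hAcwb` (★ p864498 :116–:119) at `Acw := fun X i w s h => Ac₀ X i w s (Fr ((gc X·h)_∞) w)`, the booked `Pw`, `gw := tw·pw`
      (∀ z : ℂ, 0 < z.re → ∃ (Mg : ℕ) (Cg cg rg : ℝ), 0 ≤ Cg ∧ 0 < cg ∧ 0 < rg ∧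
        ∀ (X : skewMatrices ((IsCMField.complexConj L : L ≃ₐ[Fp L] L) : L →+* L) ((gramR L e dV hdV dW hdW).map (algebraMap (Fp L) L))) (s : ℂ), dist s z < rg →
        ∀ h : HA L e dV hdV dW hdW, (X : Matrix (Fin 2) (Fin 2) L) ≠ 0 → (X : Matrix (Fin 2) (Fin 2) L).det = 0 → ∀ i ∈ I X h, ∀ w ∈ Tinf,
          ‖Ac₀ X i w s (Fr (UnitaryGroup.archPart (Fp L) L (IsCMField.complexConj L) (2 + 2) (hermD L e dV hdV dW hdW) (gc X * h)) ⟨w, IsTotallyComplex.isComplex w⟩)‖ ≤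
            Cg * (((1 + pw X h w) * (1 + (pw X h w)⁻¹)) * ((1 + tw X w) * (1 + (tw X w)⁻¹)) * (1 + Rw X h w)) ^ Mg * Real.exp (-(cg * (tw X w * pw X h w)))) := by
  -- the two class-letter packages per fine face and complex place, chosen once (before `X`)
  choose Acp hAcp hAp hGp using hKp
  choose Acn hAcn hAn hGn using hKn
  refine ⟨fun X i w s g => sc X i w s * (bif sgn X w then Acp i ⟨w, IsTotallyComplex.isComplex w⟩ a (tw X w) s g
      else Acn i ⟨w, IsTotallyComplex.isComplex w⟩ a (tw X w) s g), ?_, ?_, ?_, ?_, ?_⟩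
  · -- (C1)
    intro X hX hdet h i _ w hw g hg
    cases hb : sgn X w with
    | true =>
      simp only [hb, cond_true]
      exact (hsc X i w).mul (hAcp i _ a (tw X w) ha (htw0 X hX hdet w hw) g hg)
    | false =>
      simp only [hb, cond_false]
      exact (hsc X i w).mul (hAcn i _ a (tw X w) ha (htw0 X hX hdet w hw) g hg)
  · -- (C2p)
    intro X hX hdet h i _ w hw hb s hs g hg
    simp only [hb, cond_true]
    exact congrArg (fun y => sc X i w s * y) (hAp i _ a (tw X w) ha (htw0 X hX hdet w hw) s hs g hg)
  · -- (C2n)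
    intro X hX hdet h i _ w hw hb s hs g hg
    simp only [hb, cond_false]
    exact congrArg (fun y => sc X i w s * y) (hAn i _ a (tw X w) ha (htw0 X hX hdet w hw) s hs g hg)
  · -- (C3) `hP1`
    intro X h hX hdet w hw
    have hp : 0 < pw X h w := by rw [hpw_eq]; exact gaussParam_pos ha (hFrU _ _)
    have hR0 : 0 ≤ Rw X h w := (norm_nonneg _).trans (hRw X h w hw (Sum.inl 0) (Sum.inl 0))
    exact one_le_mul_of_one_le_of_one_le (one_le_mul_of_one_le_of_one_le (one_le_envFactor hp) (one_le_envFactor (htw0 X hX hdet w hw)))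
      (le_add_of_nonneg_right hR0)
  · -- (C4) `hAcwb`: the (v) packages at every `(i, w)`, uniformized over the finitely many `(i, w)`, times the scalar bound
    intro z hz
    choose Mp Cp rp hCp hrp hBp using fun p : φ × InfinitePlace L => hGp p.1 ⟨p.2, IsTotallyComplex.isComplex p.2⟩ z hz
    choose Mn Cn rn hCn hrn hBn using fun p : φ × InfinitePlace L => hGn p.1 ⟨p.2, IsTotallyComplex.isComplex p.2⟩ z hz
    obtain ⟨Cs, rs, hCs, hrs, hS⟩ := hscb z hz
    have hCp0 : 0 ≤ ∑ q : φ × InfinitePlace L, Cp q := Finset.sum_nonneg fun q _ => hCp q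
    have hCn0 : 0 ≤ ∑ q : φ × InfinitePlace L, Cn q := Finset.sum_nonneg fun q _ => hCn q
    have hS0 : 0 ≤ ∑ q : φ × InfinitePlace L, ((rp q)⁻¹ + (rn q)⁻¹) :=
      Finset.sum_nonneg fun q _ => add_nonneg (inv_nonneg.2 (hrp q).le) (inv_nonneg.2 (hrn q).le)
    refine ⟨Finset.univ.sup Mp + Finset.univ.sup Mn, Cs * ((∑ q : φ × InfinitePlace L, Cp q) + ∑ q : φ × InfinitePlace L, Cn q), Real.pi,
      min rs (1 + ∑ q : φ × InfinitePlace L, ((rp q)⁻¹ + (rn q)⁻¹))⁻¹, mul_nonneg hCs (add_nonneg hCp0 hCn0), Real.pi_pos,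
      lt_min hrs (by positivity), ?_⟩
    intro X s hs h hX hdet i hi w hw
    have hss : dist s z < rs := hs.trans_le (min_le_left _ _)
    have hs' : dist s z < (1 + ∑ q : φ × InfinitePlace L, ((rp q)⁻¹ + (rn q)⁻¹))⁻¹ := hs.trans_le (min_le_right _ _)
    have hmem : (i, w) ∈ (Finset.univ : Finset (φ × InfinitePlace L)) := Finset.mem_univ _
    have hsum1 : (rp (i, w))⁻¹ + (rn (i, w))⁻¹ ≤ 1 + ∑ q : φ × InfinitePlace L, ((rp q)⁻¹ + (rn q)⁻¹) :=
      (Finset.single_le_sum (f := fun q => (rp q)⁻¹ + (rn q)⁻¹) (fun q _ => add_nonneg (inv_nonneg.2 (hrp q).le) (inv_nonneg.2 (hrn q).le)) hmem).trans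
        (le_add_of_nonneg_left zero_le_one)
    have hsp : dist s z < rp (i, w) :=
      hs'.trans_le (inv_le_of_inv_le₀ (hrp _) ((le_add_of_nonneg_right (inv_nonneg.2 (hrn _).le)).trans hsum1))
    have hsn : dist s z < rn (i, w) :=
      hs'.trans_le (inv_le_of_inv_le₀ (hrn _) ((le_add_of_nonneg_left (inv_nonneg.2 (hrp _).le)).trans hsum1))
    have ht := htw0 X hX hdet w hw
    have hp : 0 < pw X h w := by rw [hpw_eq]; exact gaussParam_pos ha (hFrU _ _)
    have hR0 : 0 ≤ Rw X h w := (norm_nonneg _).trans (hRw X h w hw (Sum.inl 0) (Sum.inl 0))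
    have hSz1 : 1 ≤ ((1 + pw X h w) * (1 + (pw X h w)⁻¹)) * ((1 + tw X w) * (1 + (tw X w)⁻¹)) * (1 + Rw X h w) :=
      one_le_mul_of_one_le_of_one_le (one_le_mul_of_one_le_of_one_le (one_le_envFactor hp) (one_le_envFactor ht)) (le_add_of_nonneg_right hR0)
    have hCpq : Cp (i, w) ≤ (∑ q : φ × InfinitePlace L, Cp q) + ∑ q : φ × InfinitePlace L, Cn q :=
      (Finset.single_le_sum (f := Cp) (fun q _ => hCp q) hmem).trans (le_add_of_nonneg_right hCn0)
    have hCnq : Cn (i, w) ≤ (∑ q : φ × InfinitePlace L, Cp q) + ∑ q : φ × InfinitePlace L, Cn q :=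
      (Finset.single_le_sum (f := Cn) (fun q _ => hCn q) hmem).trans (le_add_of_nonneg_left hCp0)
    have hMp : Mp (i, w) ≤ Finset.univ.sup Mp + Finset.univ.sup Mn := (Finset.le_sup (f := Mp) hmem).trans (Nat.le_add_right _ _)
    have hMn : Mn (i, w) ≤ Finset.univ.sup Mp + Finset.univ.sup Mn := (Finset.le_sup (f := Mn) hmem).trans (Nat.le_add_left _ _)
    have hscle := hS X hX hdet h i hi w hw s hss
    rw [norm_mul]
    cases hb : sgn X w with
    | true =>
      simp only [cond_true]
      have hB := hBp (i, w) a (tw X w) ha ht _ (hFrU (UnitaryGroup.archPart (Fp L) L (IsCMField.complexConj L) (2 + 2) (hermD L e dV hdV dW hdW) (gc X * h))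
        ⟨w, IsTotallyComplex.isComplex w⟩) (Rw X h w) (hRw X h w hw) s hsp
      rw [← hpw_eq X h w, mul_comm (pw X h w) (tw X w)] at hB
      calc ‖sc X i w s‖ * ‖Acp i ⟨w, IsTotallyComplex.isComplex w⟩ a (tw X w) s (Fr (UnitaryGroup.archPart (Fp L) L (IsCMField.complexConj L) (2 + 2) (hermD L e dV hdV dW hdW) (gc X * h)) ⟨w, IsTotallyComplex.isComplex w⟩)‖
          ≤ Cs * (((∑ q : φ × InfinitePlace L, Cp q) + ∑ q : φ × InfinitePlace L, Cn q) * (((1 + pw X h w) * (1 + (pw X h w)⁻¹)) * ((1 + tw X w) * (1 + (tw X w)⁻¹)) * (1 + Rw X h w)) ^ (Finset.univ.sup Mp + Finset.univ.sup Mn) *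
              Real.exp (-(Real.pi * (tw X w * pw X h w)))) :=
            mul_le_mul hscle (hB.trans (mul_le_mul (mul_le_mul hCpq (pow_le_pow_right₀ hSz1 hMp) (by positivity) (add_nonneg hCp0 hCn0)) le_rfl
              (Real.exp_pos _).le (by positivity))) (norm_nonneg _) hCs
        _ = _ := by ring
    | false =>
      simp only [cond_false]
      have hB := hBn (i, w) a (tw X w) ha ht _ (hFrU (UnitaryGroup.archPart (Fp L) L (IsCMField.complexConj L) (2 + 2) (hermD L e dV hdV dW hdW) (gc X * h))
        ⟨w, IsTotallyComplex.isComplex w⟩) (Rw X h w) (hRw X h w hw) s hsn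
      rw [← hpw_eq X h w, mul_comm (pw X h w) (tw X w)] at hB
      calc ‖sc X i w s‖ * ‖Acn i ⟨w, IsTotallyComplex.isComplex w⟩ a (tw X w) s (Fr (UnitaryGroup.archPart (Fp L) L (IsCMField.complexConj L) (2 + 2) (hermD L e dV hdV dW hdW) (gc X * h)) ⟨w, IsTotallyComplex.isComplex w⟩)‖
          ≤ Cs * (((∑ q : φ × InfinitePlace L, Cp q) + ∑ q : φ × InfinitePlace L, Cn q) * (((1 + pw X h w) * (1 + (pw X h w)⁻¹)) * ((1 + tw X w) * (1 + (tw X w)⁻¹)) * (1 + Rw X h w)) ^ (Finset.univ.sup Mp + Finset.univ.sup Mn) *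
              Real.exp (-(Real.pi * (tw X w * pw X h w)))) :=
            mul_le_mul hscle (hB.trans (mul_le_mul (mul_le_mul hCnq (pow_le_pow_right₀ hSz1 hMn) (by positivity) (add_nonneg hCp0 hCn0)) le_rfl
              (Real.exp_pos _).le (by positivity))) (norm_nonneg _) hCs
        _ = _ := by ring

end Summit.HodgeConjecture.HodgeConjecture.Cruxes.HLiu418.K2LiuKindOneSingularArchLettersOfRecordK

end
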